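import Literature.AlgebraicGeometry.Motives.LefschetzStarExternalProduct
import Literature.AlgebraicGeometry.Motives.MotivatedCyclesPushforwardProofs
import Literature.AlgebraicGeometry.Motives.StandardConjecturesKunnethProofs
import HarnessLib

/-!
# Motivated classes are stable under cup product (André 1996, Prop. 2.1 (i)): the discharge

Y. André, *Pour une théorie inconditionnelle des motifs*, Publ. Math. IHÉS 83 (1996), §2.1,
Proposition 2.1 (i) (p. 14): «`A_mot(X)_E` est une sous-`E`-algèbre de `H•(X)` (relativement au
cup-produit)», with the printed proof of the stability under `∪` (p. 15):

  `pr^{XY}_{X*}(α ∪ ⋆β) ∪ pr^{XZ}_{X*}(γ ∪ ⋆δ) = pr^{XYXZ}_{X*}(pr^{XYXZ*}_{XX}[Δ] ∪ (α ⊗ γ) ∪ (⋆β ⊗ ⋆δ))`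
  «et l'on conclut en appliquant le lemme 1.3.2.»

This file proves `theorem motivatedClasses_cup_le_holds : W.motivatedClasses_cup_le`, the
discharge of the named fact `WeilCohomology.motivatedClasses_cup_le` of
`Motives/MotivatedCycles.lean` (stated there, since 2026-08-15, under André's standing hypothesis
`W.HasHardLefschetz` and the product-hyperplane-class hypothesis `W.HasProdHyperplaneClasses`),
for the tree's relational generators `W.IsMotivatedClass` (push-forwards expressed by the
projection formula) and their `K`-span `W.motivatedClasses`. The architecture is the printed one:

1. **The diagonal formula** (`trace_cup_cup_eq_trace_prodDiagonal`). For generators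
   `x = pr_{X*} u` (`u = α ∪ ⋆β` on `P = X × Y`) and `z = pr_{X*} v` (`v = γ ∪ ⋆'δ` on
   `Q = X × Z`), and the class `[Δ] ∈ Aⁿ(X × X)_ℚ` of the diagonal inducing the identity (axiom
   `exists_isInducedBy_id`), one has for every test class `y`
   `tr_X ((x ∪ z) ∪ y) = tr_{P×Q} ((p^*[Δ] ∪ (u ⊠ v)) ∪ pr_X^* y)`, `p : P × Q → X × X` the
   projection: i.e. `x ∪ z = pr_{X*} pr^{PQ}_{P*} (p^*[Δ] ∪ (u ⊠ v))`. Both sides are additive in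
   the class `[Δ]`, so by Künneth induction (`kunneth_induction`, axiom (B)) it suffices to compare
   them on external products `e ⊠ f`, where they factor (`trace_externalCup`) into the two
   projection formulas of `x` and `z`.
2. **Lemme 1.3.2** (`star_externalCup_star_mem_span`, file `LefschetzStarExternalProduct`):
   `⋆β ⊠ ⋆'δ` is a `K`-combination of classes `⋆_{PQ}((β ⊠ δ) ∪ (ηᶜ ⊠ η'ᵍ)) ∪ (ηᵃ ⊠ η'ᵇ)` for the
   Lefschetz involution `⋆_{PQ}` (`starOp`, hard Lefschetz) of the product polarisation
   `pr₁^* η + pr₂^* η'` of `P × Q` — a hyperplane class by `W.HasProdHyperplaneClasses`, `η`, `η'`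
   being the hyperplane classes of `P = X × Y`, `Q = X × Z` carried by the two generators. Hence
   `p^*[Δ] ∪ (u ⊠ v) = p^*[Δ] ∪ (α ⊠ γ) ∪ (⋆β ⊠ ⋆'δ)` is a `K`-combination of classes
   `A ∪ ⋆_{PQ} B` with `A = (p^*[Δ] ∪ (α ⊠ γ)) ∪ (ηᵃ ⊠ η'ᵇ)`, `B = (β ⊠ δ) ∪ (ηᶜ ⊠ η'ᵍ)` rational
   algebraic (C-lite axioms), whose push-forwards to `P` are generators `W.IsMotivatedClass` on
   `P = X × Y` with auxiliary variety `Q` (`isMotivatedClass_pushforward_cup_star`, push-forward =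
   the Poincaré-duality adjoint `W.pushforward`, `trace_cup_pushforward`).
3. **Assembly** (`cup_mem_motivatedClasses`): so `pr^{PQ}_{P*}(p^*[Δ] ∪ (u ⊠ v)) ∈ A_mot(X × Y)`,
   and `x ∪ z` satisfies the projection formula against it by step 1; the already discharged
   second half of Prop. 2.1 (ii) (`motivatedClasses_map_pushforward_fst_le_holds`, in its
   relational form `mem_motivatedClasses_of_projectionFormula`) gives `x ∪ z ∈ A_mot(X)`.

Everything is a theorem: no definitions, no named facts, no new hypotheses (net debt −1).

## References

* Y. André, *Pour une théorie inconditionnelle des motifs*, Publ. Math. IHÉS 83 (1996) 5–49: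
  §1.3 Lemme 1.3.2 (p. 13), §2.1 Déf. 1 and Prop. 2.1 (p. 14), proof of (i) (p. 15).
  [Andre1996Motifs]
* S. Kleiman, *Algebraic cycles and the Weil conjectures* (1968), §1.2 (A), (B), (C), §1.3
  (`Δ* = id`). [Kleiman1968]
-/

universe u v

open CategoryTheory AlgebraicGeometry MonoidalCategory CartesianMonoidalCategory
open scoped TensorProduct

noncomputable section

namespace Literature.AlgebraicGeometry.Motives

namespace WeilCohomology

variable {k : Type u} [Field k] {K : Type v} [Field K] [CharZero K] (W : WeilCohomology k K)

/-! ## Degree bookkeeping -/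

section Congr

variable {P Q V : SchemeOver k}

/-- Retyping the total degree of an external product inside a cup product (the two sides differ
only in the proofs of the degree identities). [folklore] -/
private theorem cup_externalCup_degree_congr {e i j d d' l : ℕ} (h : i + j = d) (h' : i + j = d')
    (H : e + d = l) (H' : e + d' = l) (s : W.obj (P ⊗ Q) e) (a : W.obj P i) (b : W.obj Q j) :
    W.cup H s (W.externalCup P Q h a b) = W.cup H' s (W.externalCup P Q h' a b) := by
  subst h h'
  rfl

/-- Retyping the total degrees of two external products inside a cup product. [folklore] -/
private theorem cup_externalCup_externalCup_degree_congr {i j d d' i' j' e e' l : ℕ} (h₁ : i + j = d)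
    (h₁' : i + j = d') (h₂ : i' + j' = e) (h₂' : i' + j' = e') (H : d + e = l) (H' : d' + e' = l)
    (a : W.obj P i) (b : W.obj Q j) (a' : W.obj P i') (b' : W.obj Q j') :
    W.cup H (W.externalCup P Q h₁ a b) (W.externalCup P Q h₂ a' b') =
      W.cup H' (W.externalCup P Q h₁' a b) (W.externalCup P Q h₂' a' b') := by
  subst h₁ h₁' h₂ h₂'
  rfl

/-- The graded-commutative reshuffle `D ∪ (E ∪ (S ∪ M)) = ((D ∪ E) ∪ M) ∪ S` when `S` or `M` has
even degree (`cup_comm` without sign, `cup_assoc`). [folklore] -/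
private theorem cup_cup_cup_reshuffle {N₀ : ℕ} (hV : IsSmoothProjective N₀ V)
    {iD iE iS iM dSM dESM dDE dDEM N : ℕ} (he : Even iS ∨ Even iM)
    (hSM : iS + iM = dSM) (hESM : iE + dSM = dESM) (hN : iD + dESM = N)
    (hDE : iD + iE = dDE) (hDEM : dDE + iM = dDEM) (hN' : dDEM + iS = N)
    (D : W.obj V iD) (E : W.obj V iE) (S : W.obj V iS) (M : W.obj V iM) :
    W.cup hN D (W.cup hESM E (W.cup hSM S M)) = W.cup hN' (W.cup hDEM (W.cup hDE D E) M) S := by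
  have hMS : iM + iS = dSM := by omega
  have hEM : iE + iM = iE + iM := rfl
  have h₁ : iE + iM + iS = dESM := by omega
  have h₂ : iD + (iE + iM) = dDEM := by omega
  rw [W.cup_comm_of_even hV hSM hMS he S M, ← W.cup_assoc hV hEM hMS h₁ hESM E M S,
    ← W.cup_assoc hV h₂ h₁ hN' hN D (W.cup hEM E M) S, ← W.cup_assoc hV hDE hEM hDEM h₂ D E M]

end Congr

/-! ## Generators obtained by push-forward along `pr_P : P × Q → P` -/

section Generator

variable {N M₀ : ℕ} {P Q : SchemeOver k}

/-- **A push-forward `pr_{P*}(A ∪ ⋆B)` is a motivated class** (André 1996, §2.1 Déf. 1, in the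
tree's relational form `W.IsMotivatedClass`): for `P`, `Q` smooth projective, `η` a hyperplane
class of `P × Q` with a Lefschetz star operator `⋆`, and `A`, `B` rational algebraic classes on
`P × Q` (degrees `b + b' = dim (P × Q)`, `a + b' = p₀ + dim Q`, `p₀ + q₀ = dim P`), the class
`pr_{P*}(A ∪ ⋆B) ∈ H^{2p₀}(P)` — push-forward = the Poincaré-duality adjoint `W.pushforward` of
`pr_P^*` — is a motivated class with auxiliary variety `Q`: the projection formula required by
`W.IsMotivatedClass` is the adjunction `trace_cup_pushforward`. [cite: Andre1996Motifs, §2.1 Déf. 1 (p. 14)] -/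
theorem isMotivatedClass_pushforward_cup_star (hP : IsSmoothProjective N P)
    (hQ : IsSmoothProjective M₀ Q) {η : W.obj (P ⊗ Q) 2} (hη : W.IsHyperplaneClass (P ⊗ Q) η)
    {S : W.GradedOp (P ⊗ Q) (P ⊗ Q)} (hS : W.IsLefschetzStar (N + M₀) η S)
    {a b b' p₀ q₀ : ℕ} (hbb' : b + b' = N + M₀) (hab : a + b' = p₀ + M₀) (hpq : p₀ + q₀ = N)
    {A : W.obj (P ⊗ Q) (2 * a)} {B : W.obj (P ⊗ Q) (2 * b)}
    (hA : A ∈ W.ratAlgebraicClasses (P ⊗ Q) a) (hB : B ∈ W.ratAlgebraicClasses (P ⊗ Q) b)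
    (he : 2 * (p₀ + M₀) + 2 * q₀ = 2 * (N + M₀)) (hd : 2 * p₀ + 2 * q₀ = 2 * N) :
    W.IsMotivatedClass N P p₀ (W.pushforward (N := N + M₀) hP (fst P Q) he hd
      (W.cup (show 2 * a + 2 * b' = 2 * (p₀ + M₀) by omega) A (S (2 * b) (2 * b') B))) := by
  refine ⟨M₀, Q, hQ, η, hη, S, hS, a, b, b', hbb', hab, A, B, hA, hB, fun q₁ hq₁ w ↦ ?_⟩
  obtain rfl : q₀ = q₁ := by omega
  rw [PreWeilCohomology.cupPairing, LinearMap.compr₂_apply, W.trace_cup_pushforward]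

end Generator

/-! ## The diagonal formula `x ∪ z = pr_{X*}(p^*[Δ] ∪ (u ⊠ v))` -/

section Diagonal

variable {n m m' : ℕ} {X Y Z : SchemeOver k}

/-- **Künneth step of the diagonal formula.** Let `x ∈ H^{2p}(X)`, `z ∈ H^{2q}(X)` satisfy the
projection formulas `tr_X (x ∪ w) = tr_{X×Y} (u ∪ pr_X^* w)`, `tr_X (z ∪ w) = tr_{X×Z} (v ∪ pr_X^* w)`
against classes `u` on `P = X × Y`, `v` on `Q = X × Z`, let `p : P × Q → X × X` be the projection
(any morphism with `p ≫ pr₁ = pr_P ≫ pr_X`, `p ≫ pr₂ = pr_Q ≫ pr_X`) and `y ∈ H^{2q''}(X)`,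
`p + q + q'' = dim X`. Then for EVERY class `E ∈ H^{2n}(X × X)`:
`tr_{P×Q} ((p^* E ∪ (u ⊠ v)) ∪ pr^* y) = tr_{X×X} ((pr₁^*(x ∪ y) ∪ E) ∪ pr₂^* z)`.
Both sides are additive in `E`; for `E = e ⊠ f` (`kunneth_induction`) one has
`p^*(e ⊠ f) = pr_X^* e ⊠ pr_X^* f`, the left side is
`tr_P (u ∪ pr_X^*(y ∪ e)) · tr_Q (v ∪ pr_X^* f) = tr_X (x ∪ (y ∪ e)) · tr_X (z ∪ f)` in the only
surviving bidegree `|e| = 2q` (`cup_externalCup_externalCup`, `cup_fst_externalCup`,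
`trace_externalCup`, axiom (A) off the top degree), and so is the right side
(`trace_cup_cup_externalCup_of_eq`). [cite: Andre1996Motifs, §2.1 proof of Prop. 2.1 (i) (p. 15)] -/
theorem trace_prodDiagonal_eq (hX : IsSmoothProjective n X) (hY : IsSmoothProjective m Y)
    (hZ : IsSmoothProjective m' Z) (π : (X ⊗ Y) ⊗ (X ⊗ Z) ⟶ X ⊗ X)
    (hπ₁ : π ≫ fst X X = fst (X ⊗ Y) (X ⊗ Z) ≫ fst X Y)
    (hπ₂ : π ≫ snd X X = snd (X ⊗ Y) (X ⊗ Z) ≫ fst X Z)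
    {p q q'' r dxy : ℕ} (hr : p + q = r) (hn : r + q'' = n) (hdxy : 2 * p + 2 * q'' = dxy)
    (u : W.obj (X ⊗ Y) (2 * (p + m))) (v : W.obj (X ⊗ Z) (2 * (q + m')))
    (x : W.obj X (2 * p)) (z : W.obj X (2 * q))
    (hx : ∀ (q₀ : ℕ) (hq₀ : p + q₀ = n) (w : W.obj X (2 * q₀)),
      W.cupPairing X n (2 * p) (2 * q₀) (by omega) x w =
        W.trace (X ⊗ Y) (n + m) (W.cup (show 2 * (p + m) + 2 * q₀ = 2 * (n + m) by omega) u
          (W.pullback (fst X Y) (2 * q₀) w)))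
    (hz : ∀ (q₁ : ℕ) (hq₁ : q + q₁ = n) (w : W.obj X (2 * q₁)),
      W.cupPairing X n (2 * q) (2 * q₁) (by omega) z w =
        W.trace (X ⊗ Z) (n + m') (W.cup (show 2 * (q + m') + 2 * q₁ = 2 * (n + m') by omega) v
          (W.pullback (fst X Z) (2 * q₁) w)))
    (y : W.obj X (2 * q'')) (H₂ : 2 * n + (2 * (p + m) + 2 * (q + m')) = 2 * ((r + m) + (n + m')))
    (H₁ : 2 * ((r + m) + (n + m')) + 2 * q'' = 2 * ((n + m) + (n + m')))
    (G₁ : dxy + 2 * n + 2 * q = 2 * (n + n)) (E : W.obj (X ⊗ X) (2 * n)) :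
    W.trace ((X ⊗ Y) ⊗ (X ⊗ Z)) ((n + m) + (n + m'))
        (W.cup H₁ (W.cup H₂ (W.pullback π (2 * n) E)
          (W.externalCup (X ⊗ Y) (X ⊗ Z) rfl u v))
          (W.pullback (fst (X ⊗ Y) (X ⊗ Z)) (2 * q'') (W.pullback (fst X Y) (2 * q'') y))) =
      W.trace (X ⊗ X) (n + n)
        (W.cup G₁ (W.cup rfl (W.pullback (fst X X) dxy (W.cup hdxy x y)) E)
          (W.pullback (snd X X) (2 * q) z)) := by
  have hXY := IsSmoothProjective.tensor_holds hX hY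
  have hXZ := IsSmoothProjective.tensor_holds hX hZ
  have hXX := IsSmoothProjective.tensor_holds hX hX
  have hPQ := IsSmoothProjective.tensor_holds hXY hXZ
  induction E using W.kunneth_induction hX hX with
  | zero => simp
  | add w w' hw hw' => simp only [map_add, LinearMap.add_apply, hw, hw']
  | ext i j hij a b =>
    -- `p^*(a ⊠ b) = pr_X^* a ⊠ pr_X^* b`
    rw [W.pullback_externalCup hPQ hXX π hij a b, hπ₁, hπ₂, W.pullback_comp, W.pullback_comp,
      LinearMap.comp_apply, LinearMap.comp_apply, ← W.externalCup_apply]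
    by_cases hi : i = 2 * q
    · -- the surviving bidegree `|a| = 2q`, `|b| = 2(p + q'')`
      subst hi
      obtain rfl : j = 2 * (p + q'') := by omega
      have hp' : 2 * q + 2 * (p + m) = 2 * (q + (p + m)) := by omega
      have hq' : 2 * (p + q'') + 2 * (q + m') = 2 * (n + m') := by omega
      have h' : 2 * (q + (p + m)) + 2 * (n + m') = 2 * ((r + m) + (n + m')) := by omega
      have H₁' : 2 * q'' + 2 * ((r + m) + (n + m')) = 2 * ((n + m) + (n + m')) := by omega
      have h₁ : 2 * q'' + 2 * (q + (p + m)) = 2 * (n + m) := by omega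
      have h'' : 2 * (n + m) + 2 * (n + m') = 2 * ((n + m) + (n + m')) := by omega
      rw [W.cup_externalCup_externalCup hXY hXZ hij rfl H₂ hp' hq' h',
        negOnePow_mul_eq_one (Or.inr ⟨p + m, by ring⟩), Units.val_one, one_smul,
        W.cup_comm_of_even hPQ H₁ H₁' (Or.inr ⟨q'', by ring⟩),
        W.cup_fst_externalCup hXY hXZ h' H₁' h₁ h'', W.trace_externalCup_of_eq hXY hXZ rfl h'']
      -- the `P`-factor: `tr_P (pr^* y ∪ (pr^* a ∪ u)) = tr_X (x ∪ (y ∪ a))`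
      have hya : 2 * q'' + 2 * q = 2 * (q'' + q) := by omega
      have Hu : 2 * (q'' + q) + 2 * (p + m) = 2 * (n + m) := by omega
      have Hu' : 2 * (p + m) + 2 * (q'' + q) = 2 * (n + m) := by omega
      have hxw := hx (q'' + q) (by omega) (W.cup hya y a)
      rw [W.cupPairing_apply] at hxw
      rw [← W.cup_assoc hXY hya hp' Hu h₁, ← W.map_cup hXY hX (fst X Y) hya y a,
        W.cup_comm_of_even hXY Hu Hu' (Or.inl ⟨q'' + q, by ring⟩), ← hxw]
      -- the `Q`-factor: `tr_Q (pr^* b ∪ v) = tr_X (z ∪ b)`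
      have hq₂ : 2 * (q + m') + 2 * (p + q'') = 2 * (n + m') := by omega
      have hzw := hz (p + q'') (by omega) b
      rw [W.cupPairing_apply] at hzw
      rw [W.cup_comm_of_even hXZ hq' hq₂ (Or.inr ⟨q + m', by ring⟩), ← hzw]
      -- the `X × X` side
      have g₁ : dxy + 2 * q = 2 * n := by omega
      have g₂ : 2 * (p + q'') + 2 * q = 2 * n := by omega
      have g₃ : 2 * p + 2 * (q'' + q) = 2 * n := by omega
      have g₄ : 2 * q + 2 * (p + q'') = 2 * n := by omega
      rw [W.trace_cup_cup_externalCup_of_eq hX hX hij G₁ g₁ g₂, W.cup_assoc hX hdxy hya g₁ g₃,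
        W.cup_comm_of_even hX g₂ g₄ (Or.inl ⟨p + q'', by ring⟩)]
    · -- off the surviving bidegree both sides vanish
      have h' : i + 2 * (p + m) + (j + 2 * (q + m')) = 2 * ((r + m) + (n + m')) := by omega
      have H₁' : 2 * q'' + 2 * ((r + m) + (n + m')) = 2 * ((n + m) + (n + m')) := by omega
      have h'' : 2 * q'' + (i + 2 * (p + m)) + (j + 2 * (q + m')) = 2 * ((n + m) + (n + m')) := by
        omega
      rw [W.cup_externalCup_externalCup hXY hXZ hij rfl H₂ rfl rfl h',
        negOnePow_mul_eq_one (Or.inr ⟨p + m, by ring⟩), Units.val_one, one_smul,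
        W.cup_comm_of_even hPQ H₁ H₁' (Or.inr ⟨q'', by ring⟩),
        W.cup_fst_externalCup hXY hXZ h' H₁' rfl h'',
        W.externalCup_eq_zero_of_ne hXY hXZ h'' (by omega), map_zero,
        W.trace_cup_cup_externalCup_of_ne hX hX hij G₁ (by omega)]

/-- **The diagonal formula** (André 1996, proof of Prop. 2.1 (i), p. 15:
`pr_{X*}(α ∪ ⋆β) ∪ pr_{X*}(γ ∪ ⋆δ) = pr^{XYXZ}_{X*}(pr^*[Δ] ∪ (α ⊗ γ) ∪ (⋆β ⊗ ⋆δ))`, here with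
`u = α ∪ ⋆β`, `v = γ ∪ ⋆δ` not yet multiplied out), in relational form: with the notation of
`trace_prodDiagonal_eq` and `D ∈ H^{2n}(X × X)` a class inducing the identity of `H^{2p+2q''}(X)`
(Kleiman's `Δ^* = id`, axiom `exists_isInducedBy_id`), for every `y ∈ H^{2q''}(X)`
`tr_X ((x ∪ z) ∪ y) = tr_{P×Q} ((p^* D ∪ (u ⊠ v)) ∪ pr_P^* pr_X^* y)`. Proof: `(x ∪ z) ∪ y = (x ∪ y) ∪ z`
(even degrees), `tr_X ((x ∪ y) ∪ z) = tr_{X×X} ((pr₁^*(x ∪ y) ∪ D) ∪ pr₂^* z)` (inducedness), and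
`trace_prodDiagonal_eq`. [cite: Andre1996Motifs, §2.1 proof of Prop. 2.1 (i) (p. 15)] -/
theorem trace_cup_cup_eq_trace_prodDiagonal (hX : IsSmoothProjective n X)
    (hY : IsSmoothProjective m Y) (hZ : IsSmoothProjective m' Z) (π : (X ⊗ Y) ⊗ (X ⊗ Z) ⟶ X ⊗ X)
    (hπ₁ : π ≫ fst X X = fst (X ⊗ Y) (X ⊗ Z) ≫ fst X Y)
    (hπ₂ : π ≫ snd X X = snd (X ⊗ Y) (X ⊗ Z) ≫ fst X Z)
    {p q q'' r : ℕ} (hr : p + q = r) (hn : r + q'' = n)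
    (u : W.obj (X ⊗ Y) (2 * (p + m))) (v : W.obj (X ⊗ Z) (2 * (q + m')))
    (x : W.obj X (2 * p)) (z : W.obj X (2 * q))
    (hx : ∀ (q₀ : ℕ) (hq₀ : p + q₀ = n) (w : W.obj X (2 * q₀)),
      W.cupPairing X n (2 * p) (2 * q₀) (by omega) x w =
        W.trace (X ⊗ Y) (n + m) (W.cup (show 2 * (p + m) + 2 * q₀ = 2 * (n + m) by omega) u
          (W.pullback (fst X Y) (2 * q₀) w)))
    (hz : ∀ (q₁ : ℕ) (hq₁ : q + q₁ = n) (w : W.obj X (2 * q₁)),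
      W.cupPairing X n (2 * q) (2 * q₁) (by omega) z w =
        W.trace (X ⊗ Z) (n + m') (W.cup (show 2 * (q + m') + 2 * q₁ = 2 * (n + m') by omega) v
          (W.pullback (fst X Z) (2 * q₁) w)))
    {D : W.obj (X ⊗ X) (2 * n)}
    (hD : ∀ (i j' : ℕ) (hj : i + j' = 2 * n), W.IsInducedBy n n D
      (LinearMap.id : W.obj X i →ₗ[K] W.obj X i) hj (show i + 2 * n + j' = 2 * (n + n) by omega))
    (y : W.obj X (2 * q'')) (h₂ : 2 * p + 2 * q = 2 * r) (h₁ : 2 * r + 2 * q'' = 2 * n)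
    (H₂ : 2 * n + (2 * (p + m) + 2 * (q + m')) = 2 * ((r + m) + (n + m')))
    (H₁ : 2 * ((r + m) + (n + m')) + 2 * q'' = 2 * ((n + m) + (n + m'))) :
    W.trace X n (W.cup h₁ (W.cup h₂ x z) y) =
      W.trace ((X ⊗ Y) ⊗ (X ⊗ Z)) ((n + m) + (n + m'))
        (W.cup H₁ (W.cup H₂ (W.pullback π (2 * n) D)
          (W.externalCup (X ⊗ Y) (X ⊗ Z) rfl u v))
          (W.pullback (fst (X ⊗ Y) (X ⊗ Z)) (2 * q'') (W.pullback (fst X Y) (2 * q'') y))) := by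
  have G₁ : 2 * p + 2 * q'' + 2 * n + 2 * q = 2 * (n + n) := by omega
  rw [W.trace_prodDiagonal_eq hX hY hZ π hπ₁ hπ₂ hr hn rfl u v x z hx hz y H₂ H₁ G₁ D]
  -- `(x ∪ z) ∪ y = (x ∪ y) ∪ z`
  have hzy : 2 * q + 2 * q'' = 2 * (q + q'') := by omega
  have hyz : 2 * q'' + 2 * q = 2 * (q + q'') := by omega
  have H : 2 * p + 2 * (q + q'') = 2 * n := by omega
  have G : 2 * p + 2 * q'' + 2 * q = 2 * n := by omega
  rw [W.cup_assoc hX h₂ hzy h₁ H, W.cup_comm_of_even hX hzy hyz (Or.inl ⟨q, by ring⟩),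
    ← W.cup_assoc hX rfl hyz G H]
  -- inducedness of the identity by `D`
  have hid := hD (2 * p + 2 * q'') (2 * q) G (W.cup rfl x y) z
  rw [LinearMap.id_apply] at hid
  exact hid

end Diagonal

/-! ## Assembly: Prop. 2.1 (i) -/

section Assembly

variable {n : ℕ} {X : SchemeOver k}

/-- **The cup product of two motivated generators is motivated** (André 1996, Prop. 2.1 (i),
proof p. 15), for the relational generators `W.IsMotivatedClass`: if `x ∈ H^{2p}(X)` and
`z ∈ H^{2q}(X)` are motivated classes (auxiliary data `(Y, η, ⋆, α, β)` and `(Z, η', ⋆', γ, δ)`),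
then `x ∪ z ∈ A_mot^{p+q}(X)`. With `P = X × Y`, `Q = X × Z`, `u = α ∪ ⋆β`, `v = γ ∪ ⋆'δ` and
`p : P × Q → X × X` the projection: `x ∪ z = pr_{X*} pr_{P*}(p^*[Δ] ∪ (u ⊠ v))`
(`trace_cup_cup_eq_trace_prodDiagonal`), `u ⊠ v = (α ⊠ γ) ∪ (⋆β ⊠ ⋆'δ)`, and by Lemme 1.3.2
(`star_externalCup_star_mem_span`, for the Lefschetz involution `starOp` of the product
polarisation of `P × Q`, a hyperplane class by `W.HasProdHyperplaneClasses`) the class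
`p^*[Δ] ∪ (u ⊠ v)` is a `K`-combination of classes `A ∪ ⋆_{PQ} B` with `A`, `B` rational algebraic,
whose push-forwards to `P` are motivated (`isMotivatedClass_pushforward_cup_star`); conclude by
`mem_motivatedClasses_of_projectionFormula` (Prop. 2.1 (ii), discharged). Above the top degree
(`p + q > dim X`) the class `x ∪ z` vanishes. [cite: Andre1996Motifs, §2.1 Prop. 2.1 (i) (p. 14), proof p. 15] -/
theorem cup_mem_motivatedClasses (hL : W.HasHardLefschetz) (hPH : W.HasProdHyperplaneClasses)
    (hX : IsSmoothProjective n X) {p q r : ℕ} (hpq : p + q = r) {x : W.obj X (2 * p)}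
    {z : W.obj X (2 * q)} (hx : W.IsMotivatedClass n X p x) (hz : W.IsMotivatedClass n X q z) :
    W.cup (show 2 * p + 2 * q = 2 * r by omega) x z ∈ W.motivatedClasses n X r := by
  -- above the top degree there is nothing to prove
  by_cases hrn : n < r
  · rw [W.eq_zero_of_lt hX (i := 2 * r) (by omega) (W.cup _ x z)]
    exact zero_mem _
  obtain ⟨q'', hn⟩ : ∃ q'', r + q'' = n := ⟨n - r, by omega⟩
  -- the data of the two generators
  obtain ⟨m, Y, hY, η, hη, S, hS, a, b, b', hbb', hab, α, β, hα, hβ, hrel⟩ := hx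
  obtain ⟨m', Z, hZ, η', hη', S', hS', a', c, c', hcc', hac, γ, δ, hγ, hδ, hrel'⟩ := hz
  have hXY := IsSmoothProjective.tensor_holds hX hY
  have hXZ := IsSmoothProjective.tensor_holds hX hZ
  have hXX := IsSmoothProjective.tensor_holds hX hX
  have hPQ := IsSmoothProjective.tensor_holds hXY hXZ
  -- the product polarisation of `P × Q` (a hyperplane class) and its Lefschetz involution
  have hΗ : W.IsHyperplaneClass ((X ⊗ Y) ⊗ (X ⊗ Z)) (W.prodPolarisation (X ⊗ Y) (X ⊗ Z) η η') :=
    hPH hXY hXZ hη hη'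
  have hS₀ := W.isLefschetzStar_starOp hL hPQ hΗ
  -- the class of the diagonal and the projection `p : P × Q → X × X`
  obtain ⟨D, hDalg, hD⟩ := W.exists_isInducedBy_id hX
  obtain ⟨π, hπ₁, hπ₂⟩ : ∃ π : (X ⊗ Y) ⊗ (X ⊗ Z) ⟶ X ⊗ X,
      π ≫ fst X X = fst (X ⊗ Y) (X ⊗ Z) ≫ fst X Y ∧
        π ≫ snd X X = snd (X ⊗ Y) (X ⊗ Z) ≫ fst X Z :=
    ⟨lift (fst _ _ ≫ fst X Y) (snd _ _ ≫ fst X Z), lift_fst _ _, lift_snd _ _⟩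
  -- degrees
  have hu : 2 * a + 2 * b' = 2 * (p + m) := by omega
  have hv : 2 * a' + 2 * c' = 2 * (q + m') := by omega
  have hαγ : 2 * a + 2 * a' = 2 * (a + a') := by omega
  have Hc : 2 * (a + a') + (2 * b' + 2 * c') = 2 * (p + m) + 2 * (q + m') := by omega
  have H₂ : 2 * n + (2 * (p + m) + 2 * (q + m')) = 2 * ((r + m) + (n + m')) := by omega
  have he : 2 * ((r + m) + (n + m')) + 2 * q'' = 2 * ((n + m) + (n + m')) := by omega
  have hd : 2 * (r + m) + 2 * q'' = 2 * (n + m) := by omega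
  -- `u ⊠ v = (α ⊠ γ) ∪ (⋆β ⊠ ⋆'δ)` (Koszul sign `+1` in even degrees)
  have hUV : W.cup Hc (W.externalCup (X ⊗ Y) (X ⊗ Z) hαγ α γ)
      (W.externalCup (X ⊗ Y) (X ⊗ Z) rfl (S (2 * b) (2 * b') β) (S' (2 * c) (2 * c') δ)) =
      W.externalCup (X ⊗ Y) (X ⊗ Z) rfl (W.cup hu α (S (2 * b) (2 * b') β))
        (W.cup hv γ (S' (2 * c) (2 * c') δ)) := by
    rw [W.cup_externalCup_externalCup hXY hXZ hαγ rfl Hc hu hv rfl,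
      negOnePow_mul_eq_one (Or.inl ⟨a', by ring⟩), Units.val_one, one_smul]
  -- rational algebraicity of `p^* D ∪ (α ⊠ γ)`, of `β ⊠ δ` and of the exterior monomials
  have hDE : W.cup (show 2 * n + 2 * (a + a') = 2 * (n + (a + a')) by omega)
      (W.pullback π (2 * n) D) (W.externalCup (X ⊗ Y) (X ⊗ Z) hαγ α γ) ∈
      W.ratAlgebraicClasses ((X ⊗ Y) ⊗ (X ⊗ Z)) (n + (a + a')) := by
    refine W.cup_mem_ratAlgebraicClasses hPQ rfl _ _
      (W.pullback_mem_ratAlgebraicClasses hPQ hXX π hDalg) ?_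
    rw [W.externalCup_apply]
    exact W.cup_mem_ratAlgebraicClasses hPQ rfl _ _
      (W.pullback_mem_ratAlgebraicClasses hPQ hXY _ hα)
      (W.pullback_mem_ratAlgebraicClasses hPQ hXZ _ hγ)
  have hβδ : W.externalCup (X ⊗ Y) (X ⊗ Z) (show 2 * b + 2 * c = 2 * (b + c) by omega) β δ ∈
      W.ratAlgebraicClasses ((X ⊗ Y) ⊗ (X ⊗ Z)) (b + c) := by
    rw [W.externalCup_apply]
    exact W.cup_mem_ratAlgebraicClasses hPQ rfl _ _
      (W.pullback_mem_ratAlgebraicClasses hPQ hXY _ hβ)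
      (W.pullback_mem_ratAlgebraicClasses hPQ hXZ _ hδ)
  have hη₁ := W.mem_ratAlgebraicClasses_of_isHyperplaneClass hXY hη
  have hη₁' := W.mem_ratAlgebraicClasses_of_isHyperplaneClass hXZ hη'
  have hmono : ∀ (i j : ℕ) (h : 2 * i + 2 * j = 2 * (i + j)),
      W.externalCup (X ⊗ Y) (X ⊗ Z) h (W.pow (X ⊗ Y) η i) (W.pow (X ⊗ Z) η' j) ∈
        W.ratAlgebraicClasses ((X ⊗ Y) ⊗ (X ⊗ Z)) (i + j) := fun i j h ↦ by
    rw [W.externalCup_apply]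
    exact W.cup_mem_ratAlgebraicClasses hPQ rfl _ _
      (W.pullback_mem_ratAlgebraicClasses hPQ hXY _ (W.pow_mem_ratAlgebraicClasses hXY hη₁ i))
      (W.pullback_mem_ratAlgebraicClasses hPQ hXZ _ (W.pow_mem_ratAlgebraicClasses hXZ hη₁' j))
  -- `pr_{P*}(p^* D ∪ ((α ⊠ γ) ∪ w))` is motivated for every `w` in the span of Lemme 1.3.2
  have hT : ∀ w ∈ Submodule.span K {z' : W.obj ((X ⊗ Y) ⊗ (X ⊗ Z)) (2 * b' + 2 * c') |
      ∃ (a₁ b₁ c₁ g₁ M M' : ℕ) (hM : 2 * b + 2 * c + (2 * c₁ + 2 * g₁) = M)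
        (hT' : M' + (2 * a₁ + 2 * b₁) = 2 * b' + 2 * c'),
        z' = W.cup hT' (W.starOp hL hPQ hΗ M M' (W.cup hM
              (W.externalCup (X ⊗ Y) (X ⊗ Z) rfl β δ)
              (W.externalCup (X ⊗ Y) (X ⊗ Z) rfl (W.pow (X ⊗ Y) η c₁) (W.pow (X ⊗ Z) η' g₁))))
            (W.externalCup (X ⊗ Y) (X ⊗ Z) rfl (W.pow (X ⊗ Y) η a₁) (W.pow (X ⊗ Z) η' b₁))},
      W.pushforward (N := (n + m) + (n + m')) hXY (fst (X ⊗ Y) (X ⊗ Z)) he hd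
        (W.cup H₂ (W.pullback π (2 * n) D)
          (W.cup Hc (W.externalCup (X ⊗ Y) (X ⊗ Z) hαγ α γ) w)) ∈
        W.motivatedClasses (n + m) (X ⊗ Y) (r + m) := by
    intro w hw
    induction hw using Submodule.span_induction with
    | zero =>
      simp only [map_zero]
      exact zero_mem _
    | add w w' _ _ hw hw' =>
      simp only [map_add]
      exact add_mem hw hw'
    | smul c₀ w _ hw =>
      simp only [map_smul]
      exact Submodule.smul_mem _ c₀ hw
    | mem w hw =>
      obtain ⟨a₁, b₁, c₁, g₁, M, M', hM, hT', rfl⟩ := hw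
      -- off total degree `2 dim (P × Q)` the star operator vanishes
      by_cases hMM : M + M' = 2 * ((n + m) + (n + m'))
      swap
      · rw [hS₀.1 M M' hMM, LinearMap.zero_apply, LinearMap.map_zero₂]
        simp only [map_zero]
        exact zero_mem _
      obtain ⟨b₀, rfl⟩ : ∃ b₀, M = 2 * b₀ := ⟨b + c + (c₁ + g₁), by omega⟩
      obtain ⟨b₀', rfl⟩ : ∃ b₀', M' = 2 * b₀' := ⟨(n + m) + (n + m') - b₀, by omega⟩
      -- retype the inner classes with even total degrees
      have hM' : 2 * (b + c) + 2 * (c₁ + g₁) = 2 * b₀ := by omega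
      have hT'' : 2 * b₀' + 2 * (a₁ + b₁) = 2 * b' + 2 * c' := by omega
      rw [W.cup_externalCup_externalCup_degree_congr rfl
          (show 2 * b + 2 * c = 2 * (b + c) by omega) rfl
          (show 2 * c₁ + 2 * g₁ = 2 * (c₁ + g₁) by omega) hM hM',
        W.cup_externalCup_degree_congr rfl (show 2 * a₁ + 2 * b₁ = 2 * (a₁ + b₁) by omega)
          hT' hT'',
        -- `p^*D ∪ ((α ⊠ γ) ∪ (⋆B ∪ mono)) = ((p^*D ∪ (α ⊠ γ)) ∪ mono) ∪ ⋆B`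
        W.cup_cup_cup_reshuffle hPQ (Or.inl ⟨b₀', by ring⟩) hT'' Hc H₂
          (show 2 * n + 2 * (a + a') = 2 * (n + (a + a')) by omega)
          (show 2 * (n + (a + a')) + 2 * (a₁ + b₁) = 2 * (n + (a + a') + (a₁ + b₁)) by omega)
          (show 2 * (n + (a + a') + (a₁ + b₁)) + 2 * b₀' = 2 * ((r + m) + (n + m')) by omega)]
      refine (W.isMotivatedClass_pushforward_cup_star hXY hXZ hΗ hS₀
        (a := n + (a + a') + (a₁ + b₁)) (b := b₀) (b' := b₀') (p₀ := r + m) (q₀ := q'')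
        (by omega) (by omega) (by omega) ?_ ?_ he hd).mem_motivatedClasses
      · exact W.cup_mem_ratAlgebraicClasses hPQ rfl _ _ hDE (hmono a₁ b₁ _)
      · exact W.cup_mem_ratAlgebraicClasses hPQ (show b + c + (c₁ + g₁) = b₀ by omega) _ _ hβδ
          (hmono c₁ g₁ _)
  -- conclusion: `x ∪ z = pr_{X*} T`, `T = pr_{P*}(p^* D ∪ (u ⊠ v))` motivated (Lemme 1.3.2)
  refine W.mem_motivatedClasses_of_projectionFormula W.motivatedClasses_map_pushforward_fst_le_holds
    hX hY (p := r) (q := q'') (c := r + m) hn (by omega)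
    (hT _ (W.star_externalCup_star_mem_span hL hPH hXY hXZ hη hη' hS hS' hS₀ rfl β δ)) fun y ↦ ?_
  rw [W.cupPairing_apply, W.trace_cup_pushforward, hUV]
  exact W.trace_cup_cup_eq_trace_prodDiagonal hX hY hZ π hπ₁ hπ₂ hpq hn
    (W.cup hu α (S (2 * b) (2 * b') β)) (W.cup hv γ (S' (2 * c) (2 * c') δ)) x z hrel hrel' hD y
    _ _ H₂ he

/-- **Discharge of the named fact `WeilCohomology.motivatedClasses_cup_le`** (André 1996, §2.1,
Prop. 2.1 (i), p. 14: «`A_mot(X)_E` est une sous-`E`-algèbre de `H•(X)`», proof p. 15; Thm. 0.3):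
for a Weil cohomology theory with the hard Lefschetz property and product hyperplane classes and
`X` smooth projective of dimension `n`, the cup product maps `A_mot^p(X) × A_mot^q(X)` into
`A_mot^{p+q}(X)`. By bilinearity (`Submodule.map₂_span_span`) it suffices to treat the
generators, `cup_mem_motivatedClasses`. [cite: Andre1996Motifs, §2.1 Prop. 2.1 (i) (pp. 14–15) with Lemme 1.3.2] -/
theorem motivatedClasses_cup_le_holds : W.motivatedClasses_cup_le := by
  intro hL hPH n X hX p q r hpq
  show Submodule.map₂ _ (Submodule.span K _) (Submodule.span K _) ≤ _
  rw [Submodule.map₂_span_span, Submodule.span_le]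
  rintro _ ⟨x, hx, z, hz, rfl⟩
  exact W.cup_mem_motivatedClasses hL hPH hX hpq hx hz

end Assembly

end WeilCohomology

end Literature.AlgebraicGeometry.Motives

end
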